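import Summits.MatrixMultiplication.OmegaCensus.SmallFormats.MatMul22nRankGF7Slack5Search
import HarnessLib

/-!
# ω-census family (a): replay of the slack-5 search certificate, CHECK A part 8 of 12 (elements `196 ≤ h < 224`)

Cell `pub-omega` (unit `pub-omega-tensor-g16`), topic `Summits/MatrixMultiplication/OmegaCensus` (sub-folder `SmallFormats`).
Framing (verbatim): lottery ticket; floor = certified bounds/negative ranges. HONEST FRAMING: machine-generated kernel replay
(`pub-omega-tensor-g16/code/gen5_runs.py`): `levelsOK5n h = true` for the elements `196 ≤ h < 224` of `PGL₂(7)`: for every slot `(c, h)`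
(`c < 656`) and bucket level, if the key of its column is visited then the bucket holds an entry with that column (SIMD key planes,
`MatMul22nRankGF7Plane`). Meaning: `slotOK5_of_levelsOK5` (`MatMul22nRankGF7Slack5SearchSound`). Nothing here is progress on `ω`.
-/

namespace Summit.MatrixMultiplication.OmegaCensus.SmallFormats

set_option Elab.async false

set_option maxRecDepth 100000 in
set_option maxHeartbeats 400000000 in
/-- Elements `196 ≤ h < 200`. -/
theorem levelsOK5_ok_196_200 : ∀ h : Fin 336, 196 ≤ h.val → h.val < 200 → levelsOK5n h.val = true := by decide +kernel

set_option maxRecDepth 100000 in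
set_option maxHeartbeats 400000000 in
/-- Elements `200 ≤ h < 204`. -/
theorem levelsOK5_ok_200_204 : ∀ h : Fin 336, 200 ≤ h.val → h.val < 204 → levelsOK5n h.val = true := by decide +kernel

set_option maxRecDepth 100000 in
set_option maxHeartbeats 400000000 in
/-- Elements `204 ≤ h < 208`. -/
theorem levelsOK5_ok_204_208 : ∀ h : Fin 336, 204 ≤ h.val → h.val < 208 → levelsOK5n h.val = true := by decide +kernel

set_option maxRecDepth 100000 in
set_option maxHeartbeats 400000000 in
/-- Elements `208 ≤ h < 212`. -/
theorem levelsOK5_ok_208_212 : ∀ h : Fin 336, 208 ≤ h.val → h.val < 212 → levelsOK5n h.val = true := by decide +kernel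

set_option maxRecDepth 100000 in
set_option maxHeartbeats 400000000 in
/-- Elements `212 ≤ h < 216`. -/
theorem levelsOK5_ok_212_216 : ∀ h : Fin 336, 212 ≤ h.val → h.val < 216 → levelsOK5n h.val = true := by decide +kernel

set_option maxRecDepth 100000 in
set_option maxHeartbeats 400000000 in
/-- Elements `216 ≤ h < 220`. -/
theorem levelsOK5_ok_216_220 : ∀ h : Fin 336, 216 ≤ h.val → h.val < 220 → levelsOK5n h.val = true := by decide +kernel

set_option maxRecDepth 100000 in
set_option maxHeartbeats 400000000 in
/-- Elements `220 ≤ h < 224`. -/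
theorem levelsOK5_ok_220_224 : ∀ h : Fin 336, 220 ≤ h.val → h.val < 224 → levelsOK5n h.val = true := by decide +kernel

/-- CHECK A for the elements `196 ≤ h < 224`. -/
theorem levelsOK5_run_8 : ∀ h : Fin 336, 196 ≤ h.val → h.val < 224 → levelsOK5n h.val = true := by
  intro h hlo hhi
  by_cases h200 : h.val < 200
  · exact levelsOK5_ok_196_200 h (by omega) h200
  by_cases h204 : h.val < 204
  · exact levelsOK5_ok_200_204 h (by omega) h204
  by_cases h208 : h.val < 208
  · exact levelsOK5_ok_204_208 h (by omega) h208
  by_cases h212 : h.val < 212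
  · exact levelsOK5_ok_208_212 h (by omega) h212
  by_cases h216 : h.val < 216
  · exact levelsOK5_ok_212_216 h (by omega) h216
  by_cases h220 : h.val < 220
  · exact levelsOK5_ok_216_220 h (by omega) h220
  exact levelsOK5_ok_220_224 h (by omega) hhi

end Summit.MatrixMultiplication.OmegaCensus.SmallFormats
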